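import Literature.AnabelianGeometry.AbsoluteAnabelian.AbsTopII.SemiEllipticTorsionFree
import Literature.AnabelianGeometry.EtaleTheta.SettingModelSemidirectTopology
import Literature.GroupTheory.CombinatorialGroupTheory.FreeGroupCompletionTorsionFree
import Mathlib.Topology.Algebra.Category.ProfiniteGrp.Completion
import Mathlib.Data.ZMod.Basic
import HarnessLib

/-!
# [AbsTopII] Cor 3.3 (ii), K4 re-close of cone node `AbsTopII:Cor3.3(ii)`: the print-faithful successor
# `Cor_3_3_iiTF` is PRODUCED at the geometric semi-elliptic model `Δ_D = F̂₂ ⊆ Δ_C = F̂₂ ⋊ {±1}`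

S. Mochizuki, *Topics in Absolute Anabelian Geometry II: Decomposition Groups and Endomorphisms*
[AbsTopII] (bib `MochizukiAbsTopII2013`; kurims manuscript `paper:url-585b8d0ad0d9`, cell render
`HOME/lit/renders/AbsTopII-kurims-url-585b8d0ad0d9/p0068.txt` l.7–11), §3, Corollary 3.3 (ii) p. 68: for a
semi-elliptic `C`, "the collection of open subgroups `Π_D ⊆ Π_C` that arise from finite étale double
coverings `D → C` that exhibit `C` as semi-elliptic [cf. Remark 3.1.1] may be characterized
'group-theoretically' as the collection of open subgroups `J ⊆ Π_C` of index `2` such that `J ∩ Δ_C` […]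
is torsion-free [i.e., the covering determined by `J` is a scheme — cf. [AbsTopI], Lemma 4.1, (iv)]";
Remark 3.1.1 p. 65: "`D_k̄ → C_k̄` [is] the unique finite étale double covering of `C_k̄` by a hyperbolic
curve".

PROOF-ONLY file (cell abc-iut, seat abc-iut-L4-t10 gen 13, row «K4 RE-CLOSE AbsTopII:Cor3.3(ii)»,
abc-iut-L4-lead m161 (2); no `def`, no instance, no new named fact; the model is built inside the proof,
as in abc-iut-w4-d071's `EllipticAdmissibleNonVacuity.lean`).  CONTEXT: the node's closer
`Cor_3_3_ii.image_doubleCovers_eq` binds the named fact `Cor_3_3_ii M` (FACT-LIST F-0234), whose right-hand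
side renders "torsion-free" by Mathlib's unique-roots class `IsMulTorsionFree` and is EMPTY at genuine data
(finding T1g11-F1; abc-iut-L4-t12's `Summit.ABC.IUTFork.not_isMulTorsionFree_of_isFreeProOn`, abc-iut-L4-t4's
`cor_3_3_ii_false_of`); abc-iut-L4-t4 minted the print-faithful successor `Cor_3_3_iiTF` and re-derived the
node closers from it (`SemiEllipticTorsionFree.lean`, `SemiEllipticTransportTF.lean`).  Missing was a
PRODUCER of the successor beyond the abelian toy `Π_C = ℤ₂` — a model at which the two renderings SEPARATE.

THIS FILE proves `exists_cor_3_3_iiTF_geometricModel`: `Cor_3_3_iiTF M` HOLDS at the **geometric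
semi-elliptic model** — the isogeny-level model (`IsogenyModel`, shape (M)) with two curves, the
once-punctured elliptic curve `D` with `Π_D = Δ_D = F̂₂` (Mathlib's profinite completion of the free group
on two letters `a, b`: the geometric fundamental group of a once-punctured elliptic curve over `k = k̄`,
`G_k = 1`) and the semi-elliptic orbicurve `C = D/{±1}` with `Π_C = Δ_C = F̂₂ ⋊ {±1}`, the involution
acting by `a ↦ a⁻¹, b ↦ b⁻¹` (the hyperelliptic involution; `F₂ ⋊ {±1} ≅ ℤ/2 ∗ ℤ/2 ∗ ℤ/2` is the orbifold
fundamental group of type `(0; 2,2,2; ∞)`, cf. the tree's `FreeProductThreeInvolutions.lean`), and the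
double covering `D → C` realised by the inclusion `F̂₂ ↪ F̂₂ ⋊ {±1}`.  The proof is the print's
Remark 3.1.1: `Δ_C` is topologically generated by its involutions `σ, aσ, bσ`, and `Δ_D = F̂₂` is
torsion-free (tree: `FreeGroup.eq_one_of_pow_eq_one_profiniteCompletion`), so an open subgroup `J` of
index `2` with `J ∩ Δ_C` torsion-free coincides with `Δ_D` (the subgroup `{t | t ∈ J ↔ t ∈ Δ_D}` is closed
and contains every torsion element) — `eq_of_index_two_of_torsionFree`.  At the SAME model the
predecessor `Cor_3_3_ii M` holds IFF `F̂₂` has unique roots (`IsMulTorsionFree F̂₂`), which abc-iut-L4-t12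
refuted (Summits-side, cited not imported): the two renderings separate inside Cor 3.3 (ii) itself.
Topology on the semidirect product: abc-iut-w5-d249's generic `SettingModel.Semidirect` toolkit (by name).

HONEST FRAMING: a MODEL (genuine profinite `Δ`'s, trivial Galois group, "scheme"/"genus"/"cusps" are the
interface's predicate-valued data), i.e. consistency-and-separation evidence for OUR typing; it is not
the anabelian reconstruction of Cor 3.3 (ii) for hyperbolic orbicurves (that producer — from [AbsTopI]
Example 4.8 / tempered input — does not exist in the tree); model ≠ reconstruction; typed ≠ proved; nothing
here bears on [IUTchIII] Cor 3.12 or asserts that abc is proved or refuted.  Axioms standard.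
-/

noncomputable section

namespace Literature.AnabelianGeometry.AbsoluteAnabelian.AbsTopII

open CategoryTheory Topology FundamentalExtension
open ProfiniteGrp ProfiniteGrp.ProfiniteCompletion
open Literature.AnabelianGeometry.EtaleTheta.SettingModel

universe u

/-! ### Helpers: the group of order two; pointwise functoriality of the profinite completion -/

/-- The two elements of `Multiplicative (ZMod 2)`. [folklore] -/
private theorem zmod_two_cases (t : Multiplicative (ZMod 2)) : t = 1 ∨ t = Multiplicative.ofAdd 1 := by
  have h : ∀ z : ZMod 2, z = 0 ∨ z = 1 := by decide
  rcases h (Multiplicative.toAdd t) with h0 | h1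
  · exact Or.inl (toAdd_eq_zero.mp h0)
  · exact Or.inr (by rw [← h1, ofAdd_toAdd])

/-- Every involution of a monoid is the image of the generator under a homomorphism from the group of
order two. [folklore] -/
private theorem exists_monoidHom_of_involution {H : Type u} [Monoid H] (h : H) (hh : h * h = 1) :
    ∃ f : Multiplicative (ZMod 2) →* H, f (Multiplicative.ofAdd 1) = h := by
  classical
  have hne : (Multiplicative.ofAdd (1 : ZMod 2)) ≠ 1 := by decide
  have hsq : Multiplicative.ofAdd (1 : ZMod 2) * Multiplicative.ofAdd (1 : ZMod 2) = 1 := by decide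
  refine ⟨{ toFun := fun t => if t = 1 then 1 else h, map_one' := if_pos rfl, map_mul' := ?_ }, ?_⟩
  · intro s t
    rcases zmod_two_cases s with rfl | rfl <;> rcases zmod_two_cases t with rfl | rfl
    · simp
    · simp
    · simp
    · rw [hsq, if_pos rfl, if_neg hne, hh]
  · change (if Multiplicative.ofAdd (1 : ZMod 2) = 1 then 1 else h) = h
    rw [if_neg hne]

/-- **Pointwise functoriality of the profinite completion** (Mathlib's `profiniteCompletion`; the
universal property of `Ĝ`, Ribes–Zalesskii §3.2): for an endomorphism `s` of `G`, the induced continuous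
endomorphism `ŝ` of `Ĝ` satisfies `ŝ (η g) = η (s g)`. [cite: RibesZalesskii2010, §3.2] -/
theorem profiniteCompletion_map_etaFn {G : Type u} [Group G] (s : G →* G) (g : G) :
    (profiniteCompletion.map (GrpCat.ofHom s)) (etaFn (GrpCat.of G) g) = etaFn (GrpCat.of G) (s g) :=
  ConcreteCategory.congr_hom (lift_eta (GrpCat.ofHom s ≫ eta (GrpCat.of G))) g

/-! ### Rmk 3.1.1 abstractly: uniqueness of a torsion-free open subgroup of index two -/

/-- **The uniqueness mechanism of [AbsTopII] Rmk 3.1.1** ("the unique finite étale double covering of `C_k̄`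
by a hyperbolic curve"), abstractly: in a topological group topologically generated by its elements of
finite order, two OPEN subgroups of index `2` without nontrivial elements of finite order COINCIDE (the
subgroup `{t | t ∈ J ↔ t ∈ K}` — a subgroup because both indices are `2` — is closed and contains all the
torsion). [cite: MochizukiAbsTopII2013, Rmk 3.1.1 p.65] -/
theorem eq_of_index_two_of_torsionFree {T : Type u} [Group T] [TopologicalSpace T] [IsTopologicalGroup T]
    {J K : Subgroup T} (hJ2 : J.index = 2) (hK2 : K.index = 2) (hJo : IsOpen (J : Set T))
    (hKo : IsOpen (K : Set T)) (hJt : ∀ g ∈ J, IsOfFinOrder g → g = 1)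
    (hKt : ∀ g ∈ K, IsOfFinOrder g → g = 1)
    (hgen : ∀ t : T, t ∈ (Subgroup.closure {g : T | IsOfFinOrder g}).topologicalClosure) : J = K := by
  -- the subgroup of elements on which membership in `J` and in `K` agree
  let S : Subgroup T :=
    { carrier := {t | t ∈ J ↔ t ∈ K}
      one_mem' := iff_of_true J.one_mem K.one_mem
      mul_mem' := fun {a b} ha hb => by
        have ha' : a ∈ J ↔ a ∈ K := ha
        have hb' : b ∈ J ↔ b ∈ K := hb
        change a * b ∈ J ↔ a * b ∈ K
        rw [Subgroup.mul_mem_iff_of_index_two hJ2, Subgroup.mul_mem_iff_of_index_two hK2, ha', hb']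
      inv_mem' := fun {a} ha => by
        have ha' : a ∈ J ↔ a ∈ K := ha
        change a⁻¹ ∈ J ↔ a⁻¹ ∈ K
        rw [inv_mem_iff, inv_mem_iff]
        exact ha' }
  -- it is closed (`J`, `K` are clopen)
  have hSc : IsClosed (S : Set T) := by
    have hS : (S : Set T) = ((J : Set T) ∩ K) ∪ ((J : Set T)ᶜ ∩ (K : Set T)ᶜ) := by
      ext t
      simp only [Set.mem_union, Set.mem_inter_iff, Set.mem_compl_iff, SetLike.mem_coe]
      change (t ∈ J ↔ t ∈ K) ↔ _
      tauto
    rw [hS]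
    exact ((Subgroup.isClosed_of_isOpen J hJo).inter (Subgroup.isClosed_of_isOpen K hKo)).union
      ((isClosed_compl_iff.2 hJo).inter (isClosed_compl_iff.2 hKo))
  -- and contains every element of finite order (such an element lies in `J`, resp. `K`, iff it is `1`)
  have htor : {g : T | IsOfFinOrder g} ⊆ (S : Set T) := by
    intro g hg
    change g ∈ J ↔ g ∈ K
    exact ⟨fun h => by rw [hJt g h hg]; exact K.one_mem, fun h => by rw [hKt g h hg]; exact J.one_mem⟩
  have hle : (Subgroup.closure {g : T | IsOfFinOrder g}).topologicalClosure ≤ S :=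
    Subgroup.topologicalClosure_minimal _ ((Subgroup.closure_le S).2 htor) hSc
  ext t
  exact hle (hgen t)

/-! ### The geometric semi-elliptic model -/

/-- **`Cor_3_3_iiTF` PRODUCED at the geometric semi-elliptic model.**  There is an isogeny-level model
`M` with a semi-elliptic `C` and a once-punctured elliptic `D` doubly covering it over `k`, such that:
the print-faithful Cor 3.3 (ii) `Cor_3_3_iiTF M` HOLDS; `Π_D ∩ Δ_C` (`= Π_D`, as `Δ_C = Π_C`: `G_k = 1`)
is isomorphic to `F̂₂`, the profinite completion of the free group on two letters; `Δ_C` contains an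
involution and is topologically generated by its torsion (it is `F̂₂ ⋊ {±1}`, the involution inverting the
letters); and the PREDECESSOR `Cor_3_3_ii M` (unique-roots rendering, F-0234) holds at `M` IFF `F̂₂` has
unique roots — refuted by abc-iut-L4-t12 (`Summit.ABC.IUTFork.not_isMulTorsionFree_of_isFreeProOn`, not
importable here): the two renderings separate at this model.  Model-level evidence only.
[cite: MochizukiAbsTopII2013, Cor 3.3 (ii) p.68] -/
theorem exists_cor_3_3_iiTF_geometricModel :
    ∃ M : IsogenyModel.{0},
      Cor_3_3_iiTF M ∧
      (Cor_3_3_ii M ↔ IsMulTorsionFree (completion (GrpCat.of (FreeGroup (Fin 2))))) ∧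
      ∃ (C D : M.Curve) (f : M.FinEt D C),
        M.IsSemiElliptic C ∧ M.IsOver f ∧ M.IsOncePuncturedElliptic D ∧ M.degree f = 2 ∧
        Nonempty (↥(M.arithImage f ⊓ (M.ext C).geom) ≃* completion (GrpCat.of (FreeGroup (Fin 2)))) ∧
        (M.ext C).geom = ⊤ ∧
        (∃ t : (M.ext C).arith, t ≠ 1 ∧ t * t = 1) ∧
        ∀ t : (M.ext C).arith,
          t ∈ (Subgroup.closure {g : (M.ext C).arith | IsOfFinOrder g}).topologicalClosure := by
  classical
  -- `F₂`, `N = F̂₂`, `η : F₂ → F̂₂` (dense image)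
  let F : Type := FreeGroup (Fin 2)
  let N : Type := completion (GrpCat.of F)
  let η : F →* N := (eta (GrpCat.of F)).hom
  have hdense : DenseRange η := denseRange (GrpCat.of F)
  -- the involution `σ₀` of `F₂` inverting the letters, and its completion `σh`
  let σ₀ : F →* F := FreeGroup.lift fun i => (FreeGroup.of i)⁻¹
  have hσ₀of : ∀ i, σ₀ (FreeGroup.of i) = (FreeGroup.of i)⁻¹ := fun i => FreeGroup.lift_apply_of
  have hσ₀σ₀ : ∀ g, σ₀ (σ₀ g) = g := fun g => DFunLike.congr_fun (FreeGroup.ext_hom (σ₀.comp σ₀)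
    (MonoidHom.id F) fun i => by rw [MonoidHom.comp_apply, hσ₀of, map_inv, hσ₀of, inv_inv]; rfl) g
  let σh : completion (GrpCat.of F) ⟶ completion (GrpCat.of F) := profiniteCompletion.map (GrpCat.ofHom σ₀)
  have hσhη : ∀ g, σh (η g) = η (σ₀ g) := fun g => profiniteCompletion_map_etaFn σ₀ g
  have hσhσh : ∀ x : N, σh (σh x) = x := fun x => congrFun (hdense.equalizer
    ((map_continuous σh.hom).comp (map_continuous σh.hom)) continuous_id
    (funext fun g => show σh (σh (η g)) = η g by rw [hσhη, hσhη, hσ₀σ₀])) x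
  let σA : MulAut N :=
    { toFun := fun x => σh x
      invFun := fun x => σh x
      left_inv := hσhσh
      right_inv := hσhσh
      map_mul' := fun a b => map_mul σh.hom a b }
  have hσA1 : σA * σA = 1 := MulEquiv.ext fun x => hσhσh x
  obtain ⟨φ, hφ⟩ := exists_monoidHom_of_involution σA hσA1
  -- the group of order two `{±1}`, discrete
  let C₂ : Type := Multiplicative (ZMod 2)
  let σ : C₂ := Multiplicative.ofAdd 1
  have hσσ : σ * σ = 1 := by decide
  have hσ1 : σ ≠ 1 := by decide
  have hφσ : ∀ n : N, (φ σ) n = σh n := fun n => by rw [hφ]; rfl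
  letI : TopologicalSpace C₂ := ⊥
  haveI : DiscreteTopology C₂ := ⟨rfl⟩
  -- `T = Π_C = Δ_C = F̂₂ ⋊ {±1}` with the product topology
  let T : Type := N ⋊[φ] C₂
  letI : TopologicalSpace T := TopologicalSpace.induced (fun g : T => (g.left, g.right)) inferInstance
  have hι : IsInducing fun g : T => (g.left, g.right) := ⟨rfl⟩
  have hact : Continuous fun q : C₂ × N => φ q.1 q.2 := by
    refine continuous_prod_of_discrete_left.2 fun a => ?_
    rcases zmod_two_cases a with rfl | rfl
    · simp only [map_one, MulAut.one_apply]; exact continuous_id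
    · exact (map_continuous σh.hom).congr fun n => (hφσ n).symm
  haveI : IsTopologicalGroup T := Semidirect.isTopologicalGroup_of_continuous_action hι hact
  haveI : CompactSpace T := Semidirect.compactSpace_of hι
  haveI : TotallyDisconnectedSpace T := Semidirect.totallyDisconnectedSpace_of hι
  -- torsion: `σ` and `η(aᵢ)·σ` are involutions, so `Δ_C` is topologically generated by torsion
  have ht_inr : IsOfFinOrder (SemidirectProduct.inr σ : T) :=
    isOfFinOrder_iff_pow_eq_one.2 ⟨2, two_pos, by rw [pow_two, ← map_mul, hσσ, map_one]⟩
  have ht_gen : ∀ i, IsOfFinOrder (⟨η (FreeGroup.of i), σ⟩ : T) := by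
    refine fun i => isOfFinOrder_iff_pow_eq_one.2 ⟨2, two_pos, ?_⟩
    rw [pow_two]
    ext
    · change η (FreeGroup.of i) * (φ σ) (η (FreeGroup.of i)) = 1
      rw [hφσ, hσhη, hσ₀of, map_inv, mul_inv_cancel]
    · exact hσσ
  have hinl_F : ∀ g : F,
      (SemidirectProduct.inl (η g) : T) ∈ Subgroup.closure {t : T | IsOfFinOrder t} := by
    have hof : ∀ i, (SemidirectProduct.inl (η (FreeGroup.of i)) : T) ∈
        Subgroup.closure {t : T | IsOfFinOrder t} := by
      intro i
      have h : (SemidirectProduct.inl (η (FreeGroup.of i)) : T) =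
          (⟨η (FreeGroup.of i), σ⟩ : T) * SemidirectProduct.inr σ := by
        ext
        · change η (FreeGroup.of i) = η (FreeGroup.of i) * (φ σ) 1; rw [map_one, mul_one]
        · change (1 : C₂) = σ * σ; rw [hσσ]
      rw [h]
      exact mul_mem (Subgroup.subset_closure (ht_gen i)) (Subgroup.subset_closure ht_inr)
    intro g
    induction g using FreeGroup.induction_on with
    | C1 => rw [map_one, map_one]; exact one_mem _
    | of x => exact hof x
    | inv_of x hx => rw [map_inv, map_inv]; exact inv_mem (hof x)
    | mul x y hx hy => rw [map_mul, map_mul]; exact mul_mem hx hy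
  have hgenT : ∀ t : T, t ∈ (Subgroup.closure {g : T | IsOfFinOrder g}).topologicalClosure := by
    have hinl : ∀ x : N,
        (SemidirectProduct.inl x : T) ∈ (Subgroup.closure {g : T | IsOfFinOrder g}).topologicalClosure := by
      intro x
      rw [← SetLike.mem_coe, Subgroup.topologicalClosure_coe]
      have hx : x ∈ closure (Set.range η) := by rw [hdense.closure_range]; exact Set.mem_univ x
      have h1 := image_closure_subset_closure_image (Semidirect.continuous_inl hι) ⟨x, hx, rfl⟩
      refine closure_mono ?_ h1
      rintro _ ⟨_, ⟨g, rfl⟩, rfl⟩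
      exact hinl_F g
    refine fun t => (SemidirectProduct.inl_left_mul_inr_right t) ▸ mul_mem (hinl t.left) ?_
    rcases zmod_two_cases t.right with h | h
    · rw [h, map_one]; exact one_mem _
    · rw [h]; exact Subgroup.le_topologicalClosure _ (Subgroup.subset_closure ht_inr)
  -- `K = Π_D = F̂₂ ⊆ T`: open, index two, torsion-free, hence the UNIQUE such subgroup
  let K : Subgroup T := (SemidirectProduct.inl : N →* T).range
  have hK_ker : K = (SemidirectProduct.rightHom : T →* C₂).ker := SemidirectProduct.range_inl_eq_ker_rightHom
  have hKo : IsOpen (K : Set T) := by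
    have h : (K : Set T) = (fun g : T => g.right) ⁻¹' {1} := by
      rw [hK_ker]; ext t
      simp only [SetLike.mem_coe, MonoidHom.mem_ker, Set.mem_preimage, Set.mem_singleton_iff]; rfl
    rw [h]
    exact (isOpen_discrete _).preimage (Semidirect.continuous_right hι)
  have hK2 : K.index = 2 := by
    rw [hK_ker, Subgroup.index_ker, MonoidHom.range_eq_top.2 SemidirectProduct.rightHom_surjective,
      Subgroup.card_top, Nat.card_eq_fintype_card]
    rfl
  have hKt : ∀ g ∈ K, IsOfFinOrder g → g = 1 := by
    rintro _ ⟨n, rfl⟩ hfin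
    obtain ⟨m, hm, hnm⟩ := ((SemidirectProduct.inl_injective).isOfFinOrder_iff.1 hfin).exists_pow_eq_one
    rw [FreeGroup.eq_one_of_pow_eq_one_profiniteCompletion n hm hnm, map_one]
  have huniq : ∀ J : Subgroup T, IsOpen (J : Set T) → J.index = 2 →
      (∀ g ∈ J, IsOfFinOrder g → g = 1) → J = K :=
    fun J hJo hJ2 hJt => eq_of_index_two_of_torsionFree hJ2 hK2 hJo hKo hJt hKt hgenT
  -- the extensions `Π_C ↠ 1`, `Π_D ↠ 1` and the morphism `D → C` (the inclusion `F̂₂ ↪ F̂₂ ⋊ {±1}`)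
  let EC : FundamentalExtension.{0} :=
    ⟨ProfiniteGrp.of T, ProfiniteGrp.of PUnit.{1}, 1, fun _ => ⟨1, Subsingleton.elim _ _⟩⟩
  let ED : FundamentalExtension.{0} :=
    ⟨completion (GrpCat.of F), ProfiniteGrp.of PUnit.{1}, 1, fun _ => ⟨1, Subsingleton.elim _ _⟩⟩
  have hgeomC : ∀ x : EC.arith, x ∈ EC.geom := fun _ => Subsingleton.elim _ _
  let inlC : N →ₜ* T :=
    { (SemidirectProduct.inl : N →* T) with continuous_toFun := Semidirect.continuous_inl hι }
  let ι : ED ⟶ EC := ⟨inlC, ContinuousMonoidHom.id _, fun _ => Subsingleton.elim _ _⟩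
  have hbij : ∀ g : ED.gal → EC.gal, Function.Bijective g :=
    fun g => ⟨fun _ _ _ => Subsingleton.elim _ _, fun y => ⟨y, Subsingleton.elim _ _⟩⟩
  have hιoi : ι.IsOpenInjective :=
    { arith_injective := SemidirectProduct.inl_injective
      isOpen_range_arith := by rw [show Set.range ι.arith = (K : Set T) from (MonoidHom.coe_range _).symm]; exact hKo
      gal_injective := fun _ _ _ => Subsingleton.elim _ _
      isOpen_range_gal := by
        rw [show Set.range ι.gal = Set.univ from Set.range_eq_univ.mpr fun x => ⟨x, rfl⟩]
        exact isOpen_univ }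
  -- the model: `true = D`, `false = C`; `k`-morphisms `D → D`, `C → C`, `D → C`
  let M : IsogenyModel.{0} :=
    { Curve := Bool
      ext := fun b => cond b ED EC
      FinEt := fun Y X => PLift (Y = X ∨ (Y = true ∧ X = false))
      extMap := fun {Y X} g =>
        match Y, X, g with
        | true, true, _ => 𝟙 ED
        | false, false, _ => 𝟙 EC
        | true, false, _ => ι
        | false, true, ⟨h⟩ => absurd h (by simp)
      extMap_isOpenInjective := fun {Y X} g =>
        match Y, X, g with
        | true, true, _ => Hom.IsOpenInjective.id ED
        | false, false, _ => Hom.IsOpenInjective.id EC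
        | true, false, _ => hιoi
        | false, true, ⟨h⟩ => absurd h (by simp)
      IsScheme := fun b => b = true
      genus := fun _ => 1
      cuspCard := fun _ => 1
      IsDefinedOverNF := fun _ => True }
  let f : M.FinEt true false := ⟨Or.inr ⟨rfl, rfl⟩⟩
  have hover : M.IsOver f := hbij _
  have hdeg : M.degree f = 2 := hK2
  have hD : M.IsOncePuncturedElliptic true := ⟨rfl, rfl, rfl⟩
  have hC : M.IsSemiElliptic false := ⟨Bool.false_ne_true, true, f, hover, hD, hdeg⟩
  -- both sides of Cor 3.3 (ii) at `C` are the singleton `{K}`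
  have hLHS : ∀ J, J ∈ M.ellipticDoubleCoverImages false ↔ J = K := by
    intro J
    constructor
    · rintro ⟨D, g, -, ⟨hDs, -, -⟩, -, rfl⟩
      cases D with
      | false => exact absurd hDs Bool.false_ne_true
      | true => rfl
    · rintro rfl
      exact ⟨true, f, hover, hD, hdeg, rfl⟩
  have hfin_iff : ∀ {J : Subgroup T} (x : ↥(J ⊓ EC.geom)), IsOfFinOrder x ↔ IsOfFinOrder (x : T) :=
    fun {J} x => ((Subgroup.subtype_injective (J ⊓ EC.geom)).isOfFinOrder_iff (x := x)).symm
  have hRHS : ∀ J, J ∈ semiEllipticDoubleCoverSubgroupsTF EC ↔ J = K := by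
    intro J
    constructor
    · rintro ⟨hJo, hJ2, hJtf⟩
      refine huniq J hJo hJ2 fun g hg hfin => ?_
      have h1 := hJtf ⟨g, Subgroup.mem_inf.2 ⟨hg, hgeomC g⟩⟩ ((hfin_iff _).2 hfin)
      exact congrArg Subtype.val h1
    · rintro rfl
      exact ⟨hKo, hK2, fun x hx => Subtype.ext (hKt _ (Subgroup.mem_inf.1 x.2).1 ((hfin_iff x).1 hx))⟩
  -- `Π_D ∩ Δ_C ≃ F̂₂`
  have hright : ∀ x : ↥(K ⊓ EC.geom), (x : T).right = 1 := fun x => by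
    have hx : (x : T) ∈ (SemidirectProduct.rightHom : T →* C₂).ker :=
      hK_ker.le (Subgroup.mem_inf.1 x.2).1
    rw [MonoidHom.mem_ker] at hx
    exact hx
  let e : ↥(K ⊓ EC.geom) ≃* N :=
    { toFun := fun x => (x : T).left
      invFun := fun n => ⟨SemidirectProduct.inl n, Subgroup.mem_inf.2 ⟨⟨n, rfl⟩, hgeomC _⟩⟩
      left_inv := fun x => Subtype.ext (by
        change SemidirectProduct.inl (x : T).left = (x : T)
        ext
        · rfl
        · exact (hright x).symm)
      right_inv := fun _ => rfl
      map_mul' := fun x y => by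
        change ((x : T) * (y : T)).left = (x : T).left * (y : T).left
        rw [SemidirectProduct.mul_left, hright x, map_one, MulAut.one_apply] }
  -- assembly
  have hinv : ∃ t : T, t ≠ 1 ∧ t * t = 1 :=
    ⟨SemidirectProduct.inr σ, fun h => hσ1 (SemidirectProduct.inr_injective (h.trans (map_one _).symm)),
      by rw [← map_mul, hσσ, map_one]⟩
  refine ⟨M, ?_, ?_, false, true, f, hC, hover, hD, hdeg, ⟨e⟩, eq_top_iff.2 fun x _ => hgeomC x,
    hinv, hgenT⟩
  · -- `Cor_3_3_iiTF M`
    intro C hCs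
    cases C with
    | true => exact absurd rfl hCs.1
    | false => exact Set.ext fun J => (hLHS J).trans (hRHS J).symm
  · -- the predecessor holds iff `F̂₂` has unique roots
    constructor
    · intro h
      have hK : K ∈ semiEllipticDoubleCoverSubgroups EC := by
        have h1 : M.ellipticDoubleCoverImages false = semiEllipticDoubleCoverSubgroups EC := h false hC
        rw [← h1]; exact (hLHS K).2 rfl
      haveI : IsMulTorsionFree ↥(K ⊓ EC.geom) := hK.2.2
      exact e.symm.injective.isMulTorsionFree e.symm.toMonoidHom
    · intro hN C hCs
      cases C with
      | true => exact absurd rfl hCs.1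
      | false =>
        refine Set.ext fun J => (hLHS J).trans ⟨?_, ?_⟩
        · rintro rfl
          exact ⟨hKo, hK2, e.injective.isMulTorsionFree e.toMonoidHom⟩
        · rintro ⟨hJo, hJ2, hJmtf⟩
          exact (hRHS J).1 ⟨hJo, hJ2, inf_geom_torsionFree_of_isMulTorsionFree hJmtf⟩

/-- **K4 census form** (cone node `AbsTopII:Cor3.3(ii)`, FACT-LIST F-0234 successor): the surviving
instance form `Cor_3_3_iiTF M` is INHABITED, with its hypothesis met (some curve is semi-elliptic), at a
model possessing a semi-elliptic double covering whose `Π_D ∩ Δ_C` is isomorphic to the free profinite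
group `F̂₂` — the shape at which the predecessor's right-hand side is empty.  Model-level evidence only.
[cite: MochizukiAbsTopII2013, Cor 3.3 (ii) p.68] -/
theorem exists_cor_3_3_iiTF_model_freeProfinite :
    ∃ M : IsogenyModel.{0}, (∃ C : M.Curve, M.IsSemiElliptic C) ∧ Cor_3_3_iiTF M ∧
      ∃ (C : M.Curve), M.IsSemiElliptic C ∧ ∃ J ∈ M.ellipticDoubleCoverImages C,
        Nonempty (↥(J ⊓ (M.ext C).geom) ≃* completion (GrpCat.of (FreeGroup (Fin 2)))) := by
  obtain ⟨M, hTF, -, C, D, f, hC, hover, hD, hdeg, he, -⟩ := exists_cor_3_3_iiTF_geometricModel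
  exact ⟨M, ⟨C, hC⟩, hTF, C, hC, M.arithImage f, ⟨D, f, hover, hD, hdeg, rfl⟩, he⟩

end Literature.AnabelianGeometry.AbsoluteAnabelian.AbsTopII

end
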